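import Summits.RiemannHypothesis.RiemannHypothesis.Theorems.PfPersistenceFloorNodeless
import Summits.RiemannHypothesis.RiemannHypothesis.Theorems.PfPersistenceWeilParityPair
import Summits.RiemannHypothesis.RiemannHypothesis.Theorems.PfPersistenceFfAngleTwin
import HarnessLib

/-!
# PF persistence — SCALE-INVARIANT readers: the typed reading of the `𝒞ᵢ` primitives (RULING A115 (5) co-sign)
(pub-rhpf barrier-typer gen 6; deprecate-and-add: no existing file is touched)

**HONEST FRAMING. This is a long-odds MECHANISM SEARCH; no RH claims.** RH-free, sorry-free linear algebra.

RULING A115 (adj-3 g19; co-signed A116) on ffmirror-2's power-twin scope clause asked the typer to co-sign the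
sentence "'scale-free functional of the served form' is the right typed reading of the cell's `𝒞ᵢ` primitives"
(ε₁ > 0, eigenvalue signs, sign-change / nodal counts of the ground profile, ratios are invariant under `T ↦ c·T`,
`c > 0`; raw levels scale and absolute thresholds on them separate a form from its positive multiples BY SCALE
ALONE — a type fact with no ζ content, A115 (A2)). This file types that reading on BOTH sides of the mirror:

* nf side (`Datum`): `ScaleInvariant S := ∀ c > 0, ∀ d, c • d ∈ S ↔ d ∈ S`; PROVED instances — the positive class
  `𝒫` and its complement (the negatives), every bottom-vector SHAPE reader of the even block
  (`scaleInvariant_bottomVectorReaderAt`: `oneSignedAt`, `floorNodelessAt φ`) and of the read-off odd block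
  (`scaleInvariant_oddBottomVectorReaderAt`, via `oddOfEven_smul`: the parity dictionary is linear), and every reader
  of the SIGN of `ε₁` (`bottomRayleigh_smul`: `ε₁(c·M) = c·ε₁(M)`); NON-instance — an absolute threshold on a raw
  entry (`not_scaleInvariant_entryThreshold`), the nf form of A115 (A2);
* the E-MOT gloss A115 (A3), typed: the power twin's ζ-side image is the positive multiple `(E:ℝ) • zetaDatum`; it is
  positive at all windows iff `ζ`'s datum is (`smul_mem_positiveClass_iff`) and NO scale-invariant criterion tells the
  two apart (`ScaleInvariant.smul_mem_iff`) — the mirror's only window image is positivity-preserving;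
* ff side (`Tower`, ffmirror-2 bd12a50de7e4): `TowerScaleInvariant Φ := ∀ c > 0, ∀ T, Φ (Tower.scale c T) = Φ T` names
  the hypothesis of `scaleInvariant_eq_of_pow`, restated as `TowerScaleInvariant.eq_of_pow`.

Per standard (33) nothing in `𝒞` is amended: `ScaleInvariant` is a READING of the primitives already filed, and a
MEMBERSHIP row may cite it by name.
-/

set_option linter.dupNamespace false

noncomputable section

open Real Set Matrix
open scoped Pointwise

namespace Summit.RiemannHypothesis.RiemannHypothesis.Theorems.PfPersistence

/-! ## §1 Scaling a datum; forms, positivity, `ε₁`, bottom vectors -/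

/-- **TYPED — SCALE-INVARIANT criterion** on the data space: membership is unchanged under `d ↦ c • d` for every
`c > 0` (all window matrices multiplied by the same positive constant). -/
def ScaleInvariant (S : Set Datum) : Prop := ∀ c : ℝ, 0 < c → ∀ d : Datum, c • d ∈ S ↔ d ∈ S

/-- PROVED: scaling acts window by window, `(c • d) win = c • d win`. [folklore] -/
theorem smul_datum_apply (c : ℝ) (d : Datum) (win : Window) : (c • d) win = c • d win := rfl

/-- PROVED: the quadratic form scales, `vᵀ (c•M) v = c · vᵀ M v`. [folklore] -/
theorem form_smul {n : ℕ} (c : ℝ) (M : Matrix (Fin n) (Fin n) ℝ) (v : Fin n → ℝ) :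
    v ⬝ᵥ ((c • M) *ᵥ v) = c * (v ⬝ᵥ (M *ᵥ v)) := by
  rw [Matrix.smul_mulVec, dotProduct_smul, smul_eq_mul]

/-- PROVED: window positivity is scale-invariant (`c > 0`). [folklore] -/
theorem windowPositive_smul_iff {n : ℕ} {c : ℝ} (hc : 0 < c) (M : Matrix (Fin n) (Fin n) ℝ) :
    WindowPositive (c • M) ↔ WindowPositive M := by
  simp only [WindowPositive, form_smul]
  constructor
  · intro h v
    have := h v
    by_contra hneg
    have : c * (v ⬝ᵥ (M *ᵥ v)) < 0 := mul_neg_of_pos_of_neg hc (lt_of_not_ge hneg)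
    linarith
  · intro h v
    exact mul_nonneg hc.le (h v)

/-- PROVED: all-window positivity is scale-invariant. [folklore] -/
theorem allWindowsPositive_smul_iff {c : ℝ} (hc : 0 < c) (d : Datum) :
    AllWindowsPositive (c • d) ↔ AllWindowsPositive d := by
  simp only [AllWindowsPositive, smul_datum_apply, windowPositive_smul_iff hc]

/-- PROVED: detectable negativity is scale-invariant. [folklore] -/
theorem detectablyNegative_smul_iff {c : ℝ} (hc : 0 < c) (d : Datum) :
    DetectablyNegative (c • d) ↔ DetectablyNegative d := by
  rw [detectablyNegative_iff_not_allWindowsPositive, detectablyNegative_iff_not_allWindowsPositive,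
    allWindowsPositive_smul_iff hc]

/-- PROVED: the Rayleigh set of `c • M` is `c •` the Rayleigh set of `M`. [folklore] -/
theorem rayleigh_setOf_smul {n : ℕ} (c : ℝ) (M : Matrix (Fin n) (Fin n) ℝ) :
    {r : ℝ | ∃ v : Fin n → ℝ, v ≠ 0 ∧ r = v ⬝ᵥ ((c • M) *ᵥ v) / (v ⬝ᵥ v)} =
      c • {r : ℝ | ∃ v : Fin n → ℝ, v ≠ 0 ∧ r = v ⬝ᵥ (M *ᵥ v) / (v ⬝ᵥ v)} := by
  ext r
  simp only [mem_setOf_eq, Set.mem_smul_set, smul_eq_mul]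
  constructor
  · rintro ⟨v, hv, rfl⟩
    exact ⟨v ⬝ᵥ (M *ᵥ v) / (v ⬝ᵥ v), ⟨v, hv, rfl⟩, by rw [form_smul]; ring⟩
  · rintro ⟨s, ⟨v, hv, rfl⟩, rfl⟩
    exact ⟨v, hv, by rw [form_smul]; ring⟩

/-- **PROVED: `ε₁(c·M) = c·ε₁(M)` for `c > 0`** — the bottom of the Rayleigh quotient is degree-1 homogeneous, so its
SIGN is scale-invariant while its raw level is not. [folklore] -/
theorem bottomRayleigh_smul {n : ℕ} {c : ℝ} (hc : 0 < c) (M : Matrix (Fin n) (Fin n) ℝ) :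
    bottomRayleigh (c • M) = c * bottomRayleigh M := by
  unfold bottomRayleigh
  rw [rayleigh_setOf_smul, Real.sInf_smul_of_nonneg hc.le, smul_eq_mul]

/-- PROVED: the sign reader `0 < ε₁` (resp. `0 ≤ ε₁`, `ε₁ < 0`) is scale-invariant. [folklore] -/
theorem bottomRayleigh_pos_smul_iff {n : ℕ} {c : ℝ} (hc : 0 < c) (M : Matrix (Fin n) (Fin n) ℝ) :
    0 < bottomRayleigh (c • M) ↔ 0 < bottomRayleigh M := by
  rw [bottomRayleigh_smul hc]
  exact ⟨fun h => pos_of_mul_pos_right h hc.le, fun h => mul_pos hc h⟩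

/-- PROVED: bottom vectors are scale-invariant (`c > 0`): `u` is a bottom vector of `c • M` iff of `M`. [folklore] -/
theorem isBottomVector_smul_iff {n : ℕ} {c : ℝ} (hc : 0 < c) (M : Matrix (Fin n) (Fin n) ℝ) (u : Fin n → ℝ) :
    IsBottomVector (c • M) u ↔ IsBottomVector M u := by
  simp only [IsBottomVector, bottomRayleigh_smul hc, Matrix.smul_mulVec, mul_smul]
  refine and_congr Iff.rfl ⟨fun h => ?_, fun h => by rw [h]⟩
  have h' := congrArg (fun x => c⁻¹ • x) h
  simpa only [smul_smul, inv_mul_cancel₀ hc.ne', inv_mul_cancel_left₀ hc.ne', one_smul] using h'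

/-! ## §2 The scale-invariant members: `𝒫`, the negatives, every bottom-vector shape reader (even and odd) -/

/-- PROVED: the positive class `𝒫` is scale-invariant. [folklore] -/
theorem scaleInvariant_positiveClass : ScaleInvariant positiveClass :=
  fun _ hc d => allWindowsPositive_smul_iff hc d

/-- PROVED: the set of detectably negative data is scale-invariant. [folklore] -/
theorem scaleInvariant_negatives : ScaleInvariant {d | DetectablyNegative d} :=
  fun _ hc d => detectablyNegative_smul_iff hc d

/-- PROVED: complements of scale-invariant criteria are scale-invariant. [folklore] -/
theorem ScaleInvariant.compl {S : Set Datum} (h : ScaleInvariant S) : ScaleInvariant Sᶜ :=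
  fun c hc d => by simp only [Set.mem_compl_iff, h c hc d]

/-- PROVED: intersections of scale-invariant criteria are scale-invariant (conjunctions of scale-free readers). [folklore] -/
theorem ScaleInvariant.inter {S T : Set Datum} (hS : ScaleInvariant S) (hT : ScaleInvariant T) :
    ScaleInvariant (S ∩ T) :=
  fun c hc d => by simp only [Set.mem_inter_iff, hS c hc d, hT c hc d]

/-- PROVED: arbitrary intersections (`∀`-window forms of scale-free per-window readers) are scale-invariant. [folklore] -/
theorem scaleInvariant_iInter {ι : Sort*} {S : ι → Set Datum} (h : ∀ i, ScaleInvariant (S i)) :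
    ScaleInvariant (⋂ i, S i) :=
  fun c hc d => by simp only [Set.mem_iInter, h _ c hc d]

/-- **PROVED: every bottom-vector SHAPE reader of the even block at one window is scale-invariant** — membership
`∃ u, IsBottomVector (d win) u ∧ P u` with `P` a property of the coefficient vector alone (one-signed, `φ`-floor
nodeless, nodal count, foot pattern, prolate alignment, …). [folklore] -/
theorem scaleInvariant_bottomVectorReaderAt (win : Window) (P : (Fin (win.N + 1) → ℝ) → Prop) :
    ScaleInvariant {d | ∃ u, IsBottomVector (d win) u ∧ P u} := by
  intro c hc d
  simp only [mem_setOf_eq, smul_datum_apply, isBottomVector_smul_iff hc]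

/-- PROVED: the raw one-signedness reader `oneSignedAt win` is scale-invariant. [folklore] -/
theorem scaleInvariant_oneSignedAt (win : Window) : ScaleInvariant (oneSignedAt win) :=
  scaleInvariant_bottomVectorReaderAt win fun u => OneSigned (2 * win.a) u

/-- PROVED: the floored nodelessness reader `floorNodelessAt φ win` (A88 add. 2 (δ)) is scale-invariant for every floor. [folklore] -/
theorem scaleInvariant_floorNodelessAt (φ : ℝ) (win : Window) : ScaleInvariant (floorNodelessAt φ win) :=
  scaleInvariant_bottomVectorReaderAt win fun u => FloorOneSigned (2 * win.a) φ u

/-- PROVED: the parity dictionary is LINEAR — the read-off odd block of `c • E` is `c •` that of `E`. [folklore] -/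
theorem oddOfEven_smul {N : ℕ} (c : ℝ) (E : Matrix (Fin (N + 1)) (Fin (N + 1)) ℝ) :
    oddOfEven (c • E) = c • oddOfEven E := by
  ext i j
  simp only [oddOfEven, deflatedBody, Matrix.smul_apply, smul_eq_mul]
  ring

/-- PROVED: `oddDatum (c • d) win = c • oddDatum d win`. [folklore] -/
theorem oddDatum_smul (c : ℝ) (d : Datum) (win : Window) : oddDatum (c • d) win = c • oddDatum d win :=
  oddOfEven_smul c (d win)

/-- **PROVED: every bottom-vector shape reader of the (read-off) ODD block at one window is scale-invariant**
(odd one-signedness on `H`, odd `φ`-floor nodelessness, odd nodal count, …). [folklore] -/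
theorem scaleInvariant_oddBottomVectorReaderAt (win : Window) (P : (Fin win.N → ℝ) → Prop) :
    ScaleInvariant {d | ∃ u, IsBottomVector (oddDatum d win) u ∧ P u} := by
  intro c hc d
  simp only [mem_setOf_eq, oddDatum_smul, isBottomVector_smul_iff hc]

/-- PROVED: every reader of the SIGN of `ε₁` at one window (even block) is scale-invariant. [folklore] -/
theorem scaleInvariant_bottomPosAt (win : Window) : ScaleInvariant {d | 0 < bottomRayleigh (d win)} := by
  intro c hc d
  simp only [mem_setOf_eq, smul_datum_apply, bottomRayleigh_pos_smul_iff hc]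

/-- PROVED: likewise for the sign of the odd `ε₁` and hence for the ORDER BIT / parity comparisons built from signs
and ratios (ratio readers: `ε₁^odd(c·d)/ε₁^ev(c·d) = ε₁^odd(d)/ε₁^ev(d)` by `bottomRayleigh_smul`). [folklore] -/
theorem scaleInvariant_oddBottomPosAt (win : Window) : ScaleInvariant {d | 0 < bottomRayleigh (oddDatum d win)} := by
  intro c hc d
  simp only [mem_setOf_eq, oddDatum_smul, bottomRayleigh_pos_smul_iff hc]

/-- PROVED: the parity ORDER BIT `ε₁^ev < ε₁^odd` at a window is scale-invariant. [folklore] -/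
theorem scaleInvariant_orderBitAt (win : Window) :
    ScaleInvariant {d | bottomRayleigh (d win) < bottomRayleigh (oddDatum d win)} := by
  intro c hc d
  simp only [mem_setOf_eq, smul_datum_apply, oddDatum_smul, bottomRayleigh_smul hc]
  exact ⟨fun h => lt_of_mul_lt_mul_left h hc.le, fun h => mul_lt_mul_of_pos_left h hc⟩

/-! ## §3 The NON-member of A115 (A2): absolute thresholds on raw levels separate by scale alone -/

/-- PROVED (A115 (A2), nf form): an ABSOLUTE THRESHOLD on a raw entry — here "`d(win)₀₀ ≥ 1`" — is NOT scale-invariant: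
the constant datum `1` passes and its positive multiple `½ • 1` fails. Such a reader separates a form from its own
positive multiples, a type fact with no arithmetic content. [folklore] -/
theorem not_scaleInvariant_entryThreshold (win : Window) : ¬ ScaleInvariant {d | 1 ≤ d win 0 0} := by
  intro h
  have h1 := (h (1 / 2) (by norm_num) fun w => (1 : Matrix (Fin (w.N + 1)) (Fin (w.N + 1)) ℝ)).2
    (by simp)
  simp only [mem_setOf_eq, smul_datum_apply, Matrix.smul_apply, Matrix.one_apply_eq, smul_eq_mul, mul_one] at h1
  norm_num at h1

/-! ## §4 The E-MOT gloss A115 (A3), typed: positive multiples of `ζ`'s datum -/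

/-- PROVED: a positive multiple of a datum is in `𝒫` iff the datum is — the power twin's ζ-side image
`(E:ℝ) • zetaDatum` is positivity-preserving. [folklore] -/
theorem smul_mem_positiveClass_iff {c : ℝ} (hc : 0 < c) (d : Datum) : c • d ∈ positiveClass ↔ d ∈ positiveClass :=
  allWindowsPositive_smul_iff hc d

/-- PROVED: NO scale-invariant criterion distinguishes a datum from its positive multiples (in particular `ζ` from
`E • ζ`, `E ≥ 1`). [folklore] -/
theorem ScaleInvariant.smul_mem_iff {S : Set Datum} (h : ScaleInvariant S) {c : ℝ} (hc : 0 < c) (d : Datum) :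
    c • d ∈ S ↔ d ∈ S :=
  h c hc d

/-- PROVED: for the ζ-side image of a power twin `h ↦ h^E`, `E ≥ 1`: `(E:ℝ) • zetaDatum ∈ S ↔ zetaDatum ∈ S` for every
scale-invariant `S`, and `(E:ℝ) • zetaDatum` is all-window positive iff `zetaDatum` is. [folklore] -/
theorem powerTwinImage_blind {S : Set Datum} (h : ScaleInvariant S) {E : ℕ} (hE : 0 < E) :
    (((E : ℝ) • zetaDatum ∈ S) ↔ zetaDatum ∈ S) ∧
      (AllWindowsPositive ((E : ℝ) • zetaDatum) ↔ AllWindowsPositive zetaDatum) :=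
  ⟨h _ (by exact_mod_cast hE) _, allWindowsPositive_smul_iff (by exact_mod_cast hE) _⟩

/-! ## §5 ff side: the tower reading (names the hypothesis of ffmirror-2's `scaleInvariant_eq_of_pow`) -/

open FfAngleTwin in
/-- **TYPED — SCALE-INVARIANT TOWER FUNCTIONAL** (A115 (5) verbatim): `Φ (c·T) = Φ T` for all `c > 0` and ALL towers
(`K(0) = g` included — the genus is in the tower and scales, A115 (A2)). -/
def TowerScaleInvariant {β : Sort*} (Φ : FfAngleTwin.Tower → β) : Prop :=
  ∀ c : ℝ, 0 < c → ∀ T : FfAngleTwin.Tower, Φ (FfAngleTwin.Tower.scale c T) = Φ T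

open FfAngleTwin in
/-- PROVED (restatement of ffmirror-2's `scaleInvariant_eq_of_pow`, bd12a50de7e4): a scale-invariant tower functional
takes the same value on the Weil window tower of `h` and of its power twin `h^E`, `E ≥ 1`. [folklore] -/
theorem TowerScaleInvariant.eq_of_pow {β : Sort*} {Φ : FfAngleTwin.Tower → β} (hΦ : TowerScaleInvariant Φ)
    (q : ℝ) (h : Polynomial ℤ) {E : ℕ} (hE : 0 < E) :
    Φ (weilWindowTower q (h ^ E)) = Φ (weilWindowTower q h) :=
  scaleInvariant_eq_of_pow hΦ q h hE

end Summit.RiemannHypothesis.RiemannHypothesis.Theorems.PfPersistence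

end
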